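import Literature.NumberTheory.EllipticCurves.KatoFineSelmerDualMuProofs
import Literature.NumberTheory.EllipticCurves.Castella2018.AnticyclotomicSelmerDualModuleFinite
import HarnessLib

/-!
# The fine Selmer group `Sel₀(K_∞, E[p^∞])`: `Sel₀[𝔪]` is finite, `X₀(E/K_∞)` is a finitely generated
# `Λ`-module (proved), and the reduction of "`Sel₀[p]` finite" to "`(conj_γ − 1)^J` kills the
# `E[p]`-lifts of `Sel₀`" (theorems only; no definition, no named fact)

Third sibling proof file of `KatoFineSelmerDual` (after `KatoFineSelmerDualProofs`: the datum
`X₀ = Hom(Sel₀(K_∞, E[p^∞]), ℚ/ℤ)` EXISTS; `KatoFineSelmerDualMuProofs`: `Sel₀[p]` finite ⟹ `X₀/(p)X₀`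
finite, Nakayama for the dual).  For an elliptic curve `E = W` over a number field `K`, ANY prime `p`,
ANY `ℤ_p`-extension `κ` (`K_∞ = K̄^{ker κ}`) with topological generator `γ`, with
`ιN : H¹(K_∞, E[p]) → H¹(K_∞, E[p^∞])` the map induced by `E[p] ↪ E[p^∞]` (tree
`WeierstrassCurve.torsionToPrimaryH1Sub`):

* `finite_setOf_fineLift_conjH1_eq` — the set of `y ∈ H¹(K_∞, E[p])` with `ιN y ∈ Sel₀(K_∞, E[p^∞])`
  and `conj_γ y = y` is FINITE.  Proof: such `y` is unramified outside `S' = {bad} ∪ {v ∣ p}` by the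
  tree's (B') `Castella2018.AcSelmer.resOfLe_torsion_eq_zero_of_forall_conjH1_mem_awayKer` (the fine
  condition at `v ∤ p` IS Greenberg's "locally trivial above `v`", `GreenbergSelmer.awayKer`), and the
  `γ`-invariant classes unramified outside a finite set are finite by the tree's descent theorem
  `finite_setOf_conjH1_eq_of_unramified_of` (Silverman X.4.3 `finite_h1Unramified_holds`;
  `ZpExtension.inertia_le_kerSubgroup_holds`).  Same assembly as
  `WeierstrassCurve.finite_setOf_selmerInfty_pTorsion_conjH1_eq` /
  `Castella2018.AcSelmer.finite_setOf_selmerAc_pTorsion_conjH1_eq`, one step shorter (no kernel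
  translates are needed at the level of lifts).
* `finite_setOf_fineSelmerInfty_pTorsion_conjH1_eq` — `Sel₀(K_∞, E[p^∞])[𝔪] = {s | p s = 0,
  conj_γ s = s}` is finite (Kummer lift `exists_torsionToPrimaryH1Sub_eq`); hence
  `FineSelmerDualData.module_finite`: **`X₀(E/K_∞)` is a finitely generated `Λ`-module** for every
  dual datum (Coates–Sujatha 2005 §3: `Y(E/F_∞)` "is a finitely generated torsion `Λ(Γ)`-module" — the
  finite generation half, for every `ℤ_p`-extension; Greenberg 1999 p. 60 for `X`, of which `X₀` is a
  quotient).
* `finite_setOf_fineLift_iterate_eq_zero` — for every `J`, the set of `y ∈ H¹(K_∞, E[p])` with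
  `ιN y ∈ Sel₀` and `(conj_γ − id)^[J] y = 0` is finite (induction on `J`: `conj_γ − 1` maps the level-`J+1`
  set to the level-`J` set, with fibres translates of the level-`1` set).
* `finite_fineSelmerInfty_pTorsion_of_forall_iterate_eq_zero` — **if `(conj_γ − id)^[J]` kills every
  `y ∈ H¹(K_∞, E[p])` with `ιN y ∈ Sel₀(K_∞, E[p^∞])`, then `Sel₀(K_∞, E[p^∞])[p]` is finite.**  This is
  the reduction used by cell `bsd-smallim` (rung K6 of `BirchSwinnertonDyer`, crux `MuTransferX9` =
  item 19276, registered stub `stub_theoremA_fine`): the cell's Theorem A (HOME/koly/MU-TRANSFER-PROOF.md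
  §5) shows exactly that a class of `𝒮 = Sel₀(ℚ_∞, E[p])` of `T`-order `≥ 2e` cannot exist, `T = γ − 1`.

HONEST FRAMING: theorems only; nothing asserted; BSD is not advanced.

References: R. Greenberg, LNM 1716 (1999), §1 p. 60, §3 Lemmas 3.1–3.2; J. Coates, R. Sujatha,
Math. Ann. 331 (2005) §3; J. H. Silverman, *AEC* X.§4 (Lemma 4.3, Cor. 4.4); L. Washington,
*Introduction to Cyclotomic Fields*, Prop. 13.2.
-/

open CategoryTheory Literature.NumberTheory.EllipticCurves Literature.NumberTheory.GaloisRepresentations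

universe u

noncomputable section

namespace WeierstrassCurve

open scoped Classical AddSubgroup
open NumberField IsDedekindDomain Field
open Literature.NumberTheory.EllipticCurves.GreenbergSelmer
open Literature.NumberTheory.EllipticCurves.Castella2018

variable {K : Type u} [Field K] [NumberField K] (W : WeierstrassCurve K) {p : ℕ} [Fact p.Prime]
  (κ : ZpExtension K p)

/-! ## `γ`-invariant `E[p]`-lifts of fine Selmer classes are finite -/

/-- **The `γ`-invariant `E[p]`-lifts of `Sel₀(K_∞, E[p^∞])` form a finite set**: for an elliptic curve
over a number field, any prime `p`, any `ℤ_p`-extension `κ` with topological generator `γ`, the set of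
`y ∈ H¹(K_∞, E[p])` whose image `ιN y ∈ H¹(K_∞, E[p^∞])` lies in the fine Selmer group and with
`conj_γ y = y` is finite.  Such `y` is unramified above every good `v ∤ p` ((B') of
`Castella2018/AnticyclotomicSelmerDualModuleFinite`, since the fine condition at `v ∤ p` is membership of
all conjugates in `GreenbergSelmer.awayKer`), and `γ`-invariant classes unramified outside a finite set
are finite (`finite_setOf_conjH1_eq_of_unramified_of`: Silverman X.4.3 + descent along `K_∞/K`,
unramified outside `p` by `ZpExtension.inertia_le_kerSubgroup_holds`).
[cite: GreenbergLNM1716, §1 p. 60 (after Conj. 1.3) and §3 Lemma 3.2] [cite: SilvermanAEC2009, Lemma X.4.3 and Cor. X.4.4] -/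
theorem finite_setOf_fineLift_conjH1_eq [W.IsElliptic] {γ : absoluteGaloisGroup K}
    (hγ : κ.IsTopGenerator γ) :
    Set.Finite {y : Literature.NumberTheory.EllipticCurves.subgroupH1 κ.kerSubgroup
        (geomTorsion W (p : ℤ)) |
      W.torsionToPrimaryH1Sub p κ.kerSubgroup y ∈ W.fineSelmerInfty κ ∧
        Literature.NumberTheory.EllipticCurves.conjH1 κ.kerSubgroup (geomTorsion W (p : ℤ)) γ y = y} := by
  classical
  have hp := (Fact.out : p.Prime)
  have hIκ : ∀ ⦃v : HeightOneSpectrum (𝓞 K)⦄, (p : 𝓞 K) ∉ v.asIdeal →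
      ∀ ⦃𝔓 : Ideal (absIntegers (𝓞 K) K)⦄, 𝔓 ∈ v.primesAbove →
        𝔓.inertia (absoluteGaloisGroup K) ≤ κ.kerSubgroup :=
    fun _ hv _ h𝔓 ↦ ZpExtension.inertia_le_kerSubgroup_holds K p κ hv h𝔓
  let ιN := W.torsionToPrimaryH1Sub p κ.kerSubgroup
  -- the finite exceptional set of places
  let S' : Set (HeightOneSpectrum (𝓞 K)) :=
    W.badPlaces (𝓞 K) ∪ {v | ((p : ℤ) : 𝓞 K) ∈ v.asIdeal}
  have hbad : (W.badPlaces (𝓞 K)).Finite := W.finite_badPlaces_holds (𝓞 K)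
  have hS' : S'.Finite := hbad.union
    (finite_setOf_intCast_mem_asIdeal (by exact_mod_cast hp.ne_zero))
  have hSp : ∀ v : HeightOneSpectrum (𝓞 K), (p : 𝓞 K) ∈ v.asIdeal → v ∈ S' := fun v hv ↦
    Or.inr (by simpa using hv)
  -- unramified predicate on `H¹(N, E[p])`
  let Unr : Literature.NumberTheory.EllipticCurves.subgroupH1 κ.kerSubgroup (geomTorsion W (p : ℤ)) →
      Prop := fun x ↦
    ∀ v : HeightOneSpectrum (𝓞 K), v ∉ S' → ∀ 𝔓 ∈ v.primesAbove,
      ∀ hle : 𝔓.inertia (absoluteGaloisGroup K) ≤ κ.kerSubgroup,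
        Literature.NumberTheory.EllipticCurves.resOfLe (geomTorsion W (p : ℤ)) hle x = 0
  -- (D) the `γ`-invariant unramified classes are finite
  haveI : Finite (geomTorsion W (p : ℤ)) :=
    finite_torsionPoints_holds W (AlgebraicClosure K) (by exact_mod_cast hp.ne_zero)
  haveI : ContinuousSMul (absoluteGaloisGroup K) (geomTorsion W (p : ℤ)) :=
    continuousSMul_geomTorsion W (isOpen_stabilizer_point_holds W) _
  have hpM : ∀ m : geomTorsion W (p : ℤ), p • m = 0 := fun m ↦
    Subtype.ext (by rw [AddSubgroupClass.coe_nsmul, ZeroMemClass.coe_zero]; exact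
      AddSubgroup.torsionBy.nsmul_iff.mp m.2)
  have hA₀ := finite_setOf_conjH1_eq_of_unramified_of κ (M := geomTorsion W (p : ℤ))
    hγ hpM (finite_h1Unramified_holds K) hIκ hS' hSp
  -- the target set is contained in `{y | conj_γ y = y ∧ Unr y}`
  refine hA₀.subset ?_
  rintro y ⟨hy1, hy2⟩
  refine ⟨hy2, fun v hv 𝔓 h𝔓 hle ↦ ?_⟩
  have hv' : v ∉ W.badPlaces (𝓞 K) := fun h ↦ hv (Or.inl h)
  have hpv : (p : 𝓞 K) ∉ v.asIdeal := fun h ↦ hv (hSp v h)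
  have hpv₀ : ((p : ℕ) : 𝓞 K) ∉ v.asIdeal := hpv
  have hy1' := (mem_strictSelmerGroupOver_iff (ιN y)).mp hy1
  exact AcSelmer.resOfLe_torsion_eq_zero_of_forall_conjH1_mem_awayKer (H := κ.kerSubgroup)
    (fun σ ↦ hy1'.1 v hpv₀ σ) hv' hpv h𝔓 hle

/-- **`Sel₀(K_∞, E[p^∞])[𝔪]` is finite**: the set of `s ∈ Sel₀(K_∞, E[p^∞])` with `p s = 0` and
`conj_γ s = s` is finite — every such `s` is `ιN y` for a `γ`-invariant lift… precisely: `s = ιN y`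
with `ιN y ∈ Sel₀` (`exists_torsionToPrimaryH1Sub_eq`), and `conj_γ y − y` lies in the finite kernel of
`ιN` (`finite_ker_torsionToPrimaryH1Sub`); so the lifts lie in finitely many translates of the finite set
of `finite_setOf_fineLift_conjH1_eq`.  The Pontryagin dual of "`X₀/𝔪X₀` is finite".
[cite: GreenbergLNM1716, §1 p. 60 (after Conj. 1.3)] [cite: CoatesSujatha2005, §3] -/
theorem finite_setOf_fineSelmerInfty_pTorsion_conjH1_eq [W.IsElliptic] {γ : absoluteGaloisGroup K}
    (hγ : κ.IsTopGenerator γ) :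
    Set.Finite {s : W.fineSelmerInfty κ |
      p • s = 0 ∧ W.conjH1 p κ.kerSubgroup γ (s : W.subgroupH1 p κ.kerSubgroup) = s} := by
  classical
  let ιN := W.torsionToPrimaryH1Sub p κ.kerSubgroup
  let cj := Literature.NumberTheory.EllipticCurves.conjH1 κ.kerSubgroup (geomTorsion W (p : ℤ)) γ
  have hA₁ := W.finite_setOf_fineLift_conjH1_eq κ hγ
  have hF₀ := W.finite_ker_torsionToPrimaryH1Sub p (H := κ.kerSubgroup)
    W.zsmul_geomPoints_surjective_holds
  -- the lifts `L = {y | ιN y ∈ Sel₀, conj_γ (ιN y) = ιN y}` are finite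
  have hL : Set.Finite {y : Literature.NumberTheory.EllipticCurves.subgroupH1 κ.kerSubgroup
      (geomTorsion W (p : ℤ)) |
      ιN y ∈ W.fineSelmerInfty κ ∧ W.conjH1 p κ.kerSubgroup γ (ιN y) = ιN y} := by
    have hsub : {y : Literature.NumberTheory.EllipticCurves.subgroupH1 κ.kerSubgroup
        (geomTorsion W (p : ℤ)) |
        ιN y ∈ W.fineSelmerInfty κ ∧ W.conjH1 p κ.kerSubgroup γ (ιN y) = ιN y} ⊆
        ⋃ f ∈ (ιN.ker : Set _), {y | ιN y ∈ W.fineSelmerInfty κ ∧ cj y - y = f} := by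
      rintro y ⟨hy1, hy2⟩
      simp only [Set.mem_iUnion, Set.mem_setOf_eq, SetLike.mem_coe, exists_prop]
      refine ⟨_, ?_, hy1, rfl⟩
      rw [AddMonoidHom.mem_ker, map_sub, ← conjH1_torsionToPrimaryH1Sub, hy2, sub_self]
    refine (hF₀.biUnion fun f _ ↦ ?_).subset hsub
    by_cases hne : {y | ιN y ∈ W.fineSelmerInfty κ ∧ cj y - y = f}.Nonempty
    · obtain ⟨y₀, hy₀S, hy₀⟩ := hne
      refine (hA₁.image fun a ↦ y₀ + a).subset ?_
      rintro y ⟨hyS, hy⟩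
      refine ⟨y - y₀, ⟨?_, ?_⟩, by abel⟩
      · rw [map_sub]
        exact (W.fineSelmerInfty κ).sub_mem hyS hy₀S
      · rw [map_sub, sub_eq_iff_eq_add.mp hy, sub_eq_iff_eq_add.mp hy₀]
        abel
    · rw [Set.not_nonempty_iff_eq_empty.mp hne]
      exact Set.finite_empty
  -- conclusion: the target set is the preimage under the (injective) coercion of `ιN '' L`
  refine ((hL.image ιN).preimage (Subtype.val_injective.injOn)).subset ?_
  rintro s ⟨hs1, hs2⟩
  have hps : p • (s : W.subgroupH1 p κ.kerSubgroup) = 0 := by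
    rw [← AddSubgroupClass.coe_nsmul, hs1, ZeroMemClass.coe_zero]
  obtain ⟨y, hy⟩ := W.exists_torsionToPrimaryH1Sub_eq p (H := κ.kerSubgroup)
    W.zsmul_geomPoints_surjective_holds hps
  refine ⟨y, ⟨?_, ?_⟩, hy⟩
  · show ιN y ∈ W.fineSelmerInfty κ
    rw [show ιN y = (s : W.subgroupH1 p κ.kerSubgroup) from hy]; exact s.2
  · show W.conjH1 p κ.kerSubgroup γ (ιN y) = ιN y
    rw [show ιN y = (s : W.subgroupH1 p κ.kerSubgroup) from hy]; exact hs2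

/-- **`X₀(E/K_∞)` is a finitely generated `Λ`-module**, for every dual fine Selmer datum, every
elliptic curve over a number field, every prime `p` and every `ℤ_p`-extension with topological generator
`γ` (Nakayama for Pontryagin duals, `FineSelmerDualData.module_finite_of_finite`, with
`finite_setOf_fineSelmerInfty_pTorsion_conjH1_eq`).  Coates–Sujatha: `Y(E/F_∞)` is a finitely
generated `Λ(Γ)`-module (the finite generation half of §3).
[cite: CoatesSujatha2005, §3] [cite: GreenbergLNM1716, §1 p. 60 (after Conj. 1.3)] -/
theorem FineSelmerDualData.module_finite [W.IsElliptic] {γ : absoluteGaloisGroup K}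
    (hγ : κ.IsTopGenerator γ) (Y : W.FineSelmerDualData κ γ) :
    Module.Finite (IwasawaAlgebra p) Y.X :=
  Y.module_finite_of_finite hγ (W.finite_setOf_fineSelmerInfty_pTorsion_conjH1_eq κ hγ)

/-! ## The lifts killed by `(conj_γ − 1)^J`, and the reduction to "some power of `T` kills the lifts" -/

/-- **For every `J`, the `E[p]`-lifts of `Sel₀(K_∞, E[p^∞])` killed by `(conj_γ − 1)^J` form a finite
set** (the power is written as the `J`-th iterate of the additive map `conj_γ − id`).  Induction on `J`:
`ψ = conj_γ − id` maps the level-`J+1` set into the level-`J` set (`Sel₀` is `conj_γ`-stable,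
`conjH1_mem_fineSelmerInfty`, and `ιN` is natural, `conjH1_torsionToPrimaryH1Sub`), and two elements with
the same image under `ψ` differ by an element of the level-`1` set, finite by
`finite_setOf_fineLift_conjH1_eq`.  (Every class is killed by SOME power of `T = γ − 1`; this is the
levelwise finiteness of the `T`-adic filtration of the `E[p]`-shadow of `Sel₀`.)
[cite: GreenbergLNM1716, §1 p. 60 (after Conj. 1.3) and §3 Lemma 3.2] -/
theorem finite_setOf_fineLift_iterate_eq_zero [W.IsElliptic] {γ : absoluteGaloisGroup K}
    (hγ : κ.IsTopGenerator γ) (J : ℕ) :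
    Set.Finite {y : Literature.NumberTheory.EllipticCurves.subgroupH1 κ.kerSubgroup
        (geomTorsion W (p : ℤ)) |
      W.torsionToPrimaryH1Sub p κ.kerSubgroup y ∈ W.fineSelmerInfty κ ∧
        (⇑(Literature.NumberTheory.EllipticCurves.conjH1 κ.kerSubgroup (geomTorsion W (p : ℤ)) γ -
            AddMonoidHom.id (Literature.NumberTheory.EllipticCurves.subgroupH1 κ.kerSubgroup
              (geomTorsion W (p : ℤ)))))^[J] y = 0} := by
  classical
  let ιN := W.torsionToPrimaryH1Sub p κ.kerSubgroup
  let ψ : Literature.NumberTheory.EllipticCurves.subgroupH1 κ.kerSubgroup (geomTorsion W (p : ℤ)) →+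
      Literature.NumberTheory.EllipticCurves.subgroupH1 κ.kerSubgroup (geomTorsion W (p : ℤ)) :=
    Literature.NumberTheory.EllipticCurves.conjH1 κ.kerSubgroup (geomTorsion W (p : ℤ)) γ -
      AddMonoidHom.id _
  have hψ : ∀ y, ψ y =
      Literature.NumberTheory.EllipticCurves.conjH1 κ.kerSubgroup (geomTorsion W (p : ℤ)) γ y - y :=
    fun y ↦ rfl
  -- level 1 = the `γ`-invariant lifts
  have hA₁ : Set.Finite {y : Literature.NumberTheory.EllipticCurves.subgroupH1 κ.kerSubgroup
      (geomTorsion W (p : ℤ)) | ιN y ∈ W.fineSelmerInfty κ ∧ ψ y = 0} := by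
    refine (W.finite_setOf_fineLift_conjH1_eq κ hγ).subset ?_
    rintro y ⟨hy1, hy2⟩
    exact ⟨hy1, sub_eq_zero.mp (by rw [← hψ]; exact hy2)⟩
  -- `ψ` preserves the lift condition
  have hψS : ∀ y, ιN y ∈ W.fineSelmerInfty κ → ιN (ψ y) ∈ W.fineSelmerInfty κ := by
    intro y hy
    rw [hψ, map_sub]
    refine (W.fineSelmerInfty κ).sub_mem ?_ hy
    rw [← conjH1_torsionToPrimaryH1Sub]
    exact W.conjH1_mem_fineSelmerInfty κ γ hy
  change Set.Finite {y | ιN y ∈ W.fineSelmerInfty κ ∧ (⇑ψ)^[J] y = 0}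
  induction J with
  | zero =>
    refine (Set.finite_singleton (0 : Literature.NumberTheory.EllipticCurves.subgroupH1 κ.kerSubgroup
      (geomTorsion W (p : ℤ)))).subset ?_
    rintro y ⟨-, hy⟩
    rw [Function.iterate_zero, id_eq] at hy
    exact hy
  | succ J ih =>
    -- `A_{J+1} ⊆ ⋃_{a ∈ A_J} (fibre of ψ over a)`, each fibre a translate of `A_1`
    have hsub : {y : Literature.NumberTheory.EllipticCurves.subgroupH1 κ.kerSubgroup
        (geomTorsion W (p : ℤ)) | ιN y ∈ W.fineSelmerInfty κ ∧ (⇑ψ)^[J + 1] y = 0} ⊆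
        ⋃ a ∈ {a : Literature.NumberTheory.EllipticCurves.subgroupH1 κ.kerSubgroup
          (geomTorsion W (p : ℤ)) | ιN a ∈ W.fineSelmerInfty κ ∧ (⇑ψ)^[J] a = 0},
          {y | ιN y ∈ W.fineSelmerInfty κ ∧ ψ y = a} := by
      rintro y ⟨hy1, hy2⟩
      simp only [Set.mem_iUnion, Set.mem_setOf_eq, exists_prop]
      refine ⟨ψ y, ⟨hψS y hy1, ?_⟩, hy1, rfl⟩
      rw [Function.iterate_succ_apply] at hy2
      exact hy2
    refine (ih.biUnion fun a _ ↦ ?_).subset hsub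
    by_cases hne : {y : Literature.NumberTheory.EllipticCurves.subgroupH1 κ.kerSubgroup
        (geomTorsion W (p : ℤ)) | ιN y ∈ W.fineSelmerInfty κ ∧ ψ y = a}.Nonempty
    · obtain ⟨y₀, hy₀S, hy₀⟩ := hne
      refine (hA₁.image fun b ↦ y₀ + b).subset ?_
      rintro y ⟨hyS, hy⟩
      refine ⟨y - y₀, ⟨?_, ?_⟩, by abel⟩
      · rw [map_sub]
        exact (W.fineSelmerInfty κ).sub_mem hyS hy₀S
      · rw [map_sub, hy, hy₀, sub_self]
    · rw [Set.not_nonempty_iff_eq_empty.mp hne]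
      exact Set.finite_empty

/-- **Reduction used by the `μ`-transfer of cell `bsd-smallim` (crux `MuTransferX9`, item 19276, stub
`stub_coreX9`): if some iterate `(conj_γ − id)^J` kills every `y ∈ H¹(K_∞, E[p])` whose image lies in
`Sel₀(K_∞, E[p^∞])`, then `Sel₀(K_∞, E[p^∞])[p]` is finite** — every `p`-torsion fine Selmer class is
`ιN y` for such a `y` (`exists_torsionToPrimaryH1Sub_eq`), and those `y` form a finite set
(`finite_setOf_fineLift_iterate_eq_zero`).  With `FineSelmerDualData.finite_quotient_augIdealP_of_finite_pTorsion`
(file `KatoFineSelmerDualMuProofs`) this gives `X₀/(p)X₀` finite, i.e. `μ(X₀(E/K_∞)) = 0`.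
[cite: GreenbergLNM1716, §1 p. 60 (after Conj. 1.3)] -/
theorem finite_fineSelmerInfty_pTorsion_of_forall_iterate_eq_zero [W.IsElliptic]
    {γ : absoluteGaloisGroup K} (hγ : κ.IsTopGenerator γ) {J : ℕ}
    (hJ : ∀ y : Literature.NumberTheory.EllipticCurves.subgroupH1 κ.kerSubgroup (geomTorsion W (p : ℤ)),
      W.torsionToPrimaryH1Sub p κ.kerSubgroup y ∈ W.fineSelmerInfty κ →
        (⇑(Literature.NumberTheory.EllipticCurves.conjH1 κ.kerSubgroup (geomTorsion W (p : ℤ)) γ -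
            AddMonoidHom.id (Literature.NumberTheory.EllipticCurves.subgroupH1 κ.kerSubgroup
              (geomTorsion W (p : ℤ)))))^[J] y = 0) :
    Set.Finite {s : W.fineSelmerInfty κ | p • s = 0} := by
  classical
  let ιN := W.torsionToPrimaryH1Sub p κ.kerSubgroup
  have hL := W.finite_setOf_fineLift_iterate_eq_zero κ hγ J
  refine ((hL.image ιN).preimage (Subtype.val_injective.injOn)).subset ?_
  intro s hs
  have hps : p • (s : W.subgroupH1 p κ.kerSubgroup) = 0 := by
    rw [← AddSubgroupClass.coe_nsmul, hs, ZeroMemClass.coe_zero]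
  obtain ⟨y, hy⟩ := W.exists_torsionToPrimaryH1Sub_eq p (H := κ.kerSubgroup)
    W.zsmul_geomPoints_surjective_holds hps
  have hyS : ιN y ∈ W.fineSelmerInfty κ := by
    rw [show ιN y = (s : W.subgroupH1 p κ.kerSubgroup) from hy]; exact s.2
  exact ⟨y, ⟨hyS, hJ y hyS⟩, hy⟩

end WeierstrassCurve

end
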